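import Mathlib
import Literature.Probability.LatticeModels.LatticeGreenFunction
import Summits.QuantumFields.YangMills.Theorems.ScalingWindowSplitSelfNormalisedSkewnessStubRingSmearingBoundGroup
import HarnessLib

/-!
# Crux `SelfNormalisedSkewness` (stmt-QuantumFields-18944), line `Sketch`, stub `stub_ringSmearingBound`:
# the smeared odd ring is `O(a log S)`

For Schwartz `f, g, h` on `ℝ⁴` with pairwise disjoint supports, `0 < a ≤ 1`, `a² L = 1` and the
torus of side `S = 2L+1`, the triple lattice sum of `f(ax) g(ay) h(az)` against the odd ring
`∑_{α,α',α''} πK(x̄-ȳ)_{αα'} πK(ȳ-z̄)_{α'α''} πK(z̄-x̄)_{α''α}` of lattice `F`-propagators is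
`O(a (1 + log S))`, GIVEN the ring bound `hRing` (one factor of the ring decays like `dist⁻⁵` up to
the zero-mode background `S⁻⁴`, the other two like `dist⁻⁴`; this is the separately proved stub
`stub_ringTraceBound`, taken here as a hypothesis).

Proof: `|∑| ≤ ∑ |·|`; for distinct `x, y, z ∈ box 4 L` the torus points are distinct
(`proj_sub_proj_ne_zero_of_mem_box`), so `hRing` applies and bounds each term by
`|f| |g| |h| · C_R [g₁ + g₂ + g₃]`; the three groups are cyclic relabellings
(`sum_distinct_triples_rotate`) of the single group estimate `ringSmearing_group_bound`
(file `…StubRingSmearingBoundGroup`), applied to `(f,g,h)`, `(g,h,f)`, `(h,f,g)`. Folklore bookkeeping;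
no named facts are used.
-/

noncomputable section

open scoped BigOperators
open Literature.MathematicalPhysics.QuantumLattice (siteToE)
open Literature.Probability.LatticeModels (Site TorusSite torusGreen Torus.proj box)

namespace Summit.QuantumFields.YangMills.Theorems.SelfNormalisedSkewness.Negative

/-! ### Sums over ordered triples of distinct points -/

/-- Nested `erase` sums over ordered triples of distinct points, as a guarded sum over the full
cube. [folklore] -/
theorem sum_distinct_triples_eq_sum_ite {α : Type*} [DecidableEq α] (B : Finset α)
    (Φ : α → α → α → ℝ) :
    ∑ x ∈ B, ∑ y ∈ B.erase x, ∑ z ∈ (B.erase x).erase y, Φ x y z =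
      ∑ x ∈ B, ∑ y ∈ B, ∑ z ∈ B, if x ≠ y ∧ x ≠ z ∧ y ≠ z then Φ x y z else 0 := by
  refine Finset.sum_congr rfl fun x _ => ?_
  rw [← Finset.filter_ne B x, Finset.sum_filter]
  refine Finset.sum_congr rfl fun y _ => ?_
  rw [← Finset.filter_ne, Finset.filter_filter, Finset.sum_filter]
  split_ifs with hxy
  · exact Finset.sum_congr rfl fun z _ => by simp [hxy]
  · exact (Finset.sum_eq_zero fun z _ => if_neg fun h => hxy h.1).symm

/-- Cyclic relabelling `(x,y,z) ↦ (z,x,y)` of a sum over ordered triples of distinct points.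
[folklore] -/
theorem sum_distinct_triples_rotate {α : Type*} [DecidableEq α] (B : Finset α)
    (Φ : α → α → α → ℝ) :
    ∑ x ∈ B, ∑ y ∈ B.erase x, ∑ z ∈ (B.erase x).erase y, Φ z x y =
      ∑ x ∈ B, ∑ y ∈ B.erase x, ∑ z ∈ (B.erase x).erase y, Φ x y z := by
  rw [sum_distinct_triples_eq_sum_ite B (fun x y z => Φ z x y), sum_distinct_triples_eq_sum_ite B Φ,
    Finset.sum_comm_cycle]
  refine Finset.sum_congr rfl fun x _ => Finset.sum_congr rfl fun y _ =>
    Finset.sum_congr rfl fun z _ => ?_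
  have hiff : (y ≠ z ∧ y ≠ x ∧ z ≠ x) ↔ (x ≠ y ∧ x ≠ z ∧ y ≠ z) :=
    ⟨fun h => ⟨h.2.1.symm, h.2.2.symm, h.1⟩, fun h => ⟨h.2.2, h.1.symm, h.2.1.symm⟩⟩
  rw [if_congr hiff rfl rfl]

/-- Cyclic relabelling `(x,y,z) ↦ (y,z,x)` of a sum over ordered triples of distinct points.
[folklore] -/
theorem sum_distinct_triples_rotate' {α : Type*} [DecidableEq α] (B : Finset α)
    (Φ : α → α → α → ℝ) :
    ∑ x ∈ B, ∑ y ∈ B.erase x, ∑ z ∈ (B.erase x).erase y, Φ y z x =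
      ∑ x ∈ B, ∑ y ∈ B.erase x, ∑ z ∈ (B.erase x).erase y, Φ x y z :=
  (sum_distinct_triples_rotate B (fun a b c => Φ c a b)).trans (sum_distinct_triples_rotate B Φ)

/-! ### Assembling the three groups -/

/-- **Assembling the three groups.** If each term of a triple sum over distinct points is bounded by
`F(x) G(y) H(z) · C_R · [g₁ + g₂ + g₃]` (the three groups of the ring bound, `g₂, g₃` the cyclic
images of `g₁ = (r(x̄-ȳ)⁵ + E) r(ȳ-z̄)⁴ r(z̄-x̄)⁴`) and the group sums for `(F,G,H)`, `(G,H,F)`,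
`(H,F,G)` are bounded by `b₁, b₂, b₃`, then the triple sum is at most `C_R (b₁ + b₂ + b₃)` in
absolute value (`sum_distinct_triples_rotate`). [folklore] -/
theorem ringSmearing_triple_sum_abs_le {α T : Type*} [DecidableEq α] [AddCommGroup T]
    (B : Finset α) (p : α → T) (r : T → ℝ) (E CR : ℝ) (hCR : 0 ≤ CR)
    (t : α → α → α → ℝ) (F G Hc : α → ℝ)
    (hpt : ∀ x ∈ B, ∀ y ∈ B.erase x, ∀ z ∈ (B.erase x).erase y,
      |t x y z| ≤ F x * G y * Hc z * (CR *
        ((r (p x - p y) ^ 5 + E) * r (p y - p z) ^ 4 * r (p z - p x) ^ 4 +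
         (r (p y - p z) ^ 5 + E) * r (p x - p y) ^ 4 * r (p z - p x) ^ 4 +
         (r (p z - p x) ^ 5 + E) * r (p x - p y) ^ 4 * r (p y - p z) ^ 4)))
    {b₁ b₂ b₃ : ℝ}
    (h₁ : ∑ x ∈ B, ∑ y ∈ B.erase x, ∑ z ∈ (B.erase x).erase y,
      F x * G y * Hc z * ((r (p x - p y) ^ 5 + E) * r (p y - p z) ^ 4 * r (p z - p x) ^ 4) ≤ b₁)
    (h₂ : ∑ x ∈ B, ∑ y ∈ B.erase x, ∑ z ∈ (B.erase x).erase y,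
      G x * Hc y * F z * ((r (p x - p y) ^ 5 + E) * r (p y - p z) ^ 4 * r (p z - p x) ^ 4) ≤ b₂)
    (h₃ : ∑ x ∈ B, ∑ y ∈ B.erase x, ∑ z ∈ (B.erase x).erase y,
      Hc x * F y * G z * ((r (p x - p y) ^ 5 + E) * r (p y - p z) ^ 4 * r (p z - p x) ^ 4) ≤ b₃) :
    |∑ x ∈ B, ∑ y ∈ B.erase x, ∑ z ∈ (B.erase x).erase y, t x y z| ≤ CR * (b₁ + b₂ + b₃) := by
  have e₂ : ∑ x ∈ B, ∑ y ∈ B.erase x, ∑ z ∈ (B.erase x).erase y,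
      G y * Hc z * F x * ((r (p y - p z) ^ 5 + E) * r (p z - p x) ^ 4 * r (p x - p y) ^ 4) =
      ∑ x ∈ B, ∑ y ∈ B.erase x, ∑ z ∈ (B.erase x).erase y,
      G x * Hc y * F z * ((r (p x - p y) ^ 5 + E) * r (p y - p z) ^ 4 * r (p z - p x) ^ 4) :=
    sum_distinct_triples_rotate' B (fun x y z =>
      G x * Hc y * F z * ((r (p x - p y) ^ 5 + E) * r (p y - p z) ^ 4 * r (p z - p x) ^ 4))
  have e₃ : ∑ x ∈ B, ∑ y ∈ B.erase x, ∑ z ∈ (B.erase x).erase y,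
      Hc z * F x * G y * ((r (p z - p x) ^ 5 + E) * r (p x - p y) ^ 4 * r (p y - p z) ^ 4) =
      ∑ x ∈ B, ∑ y ∈ B.erase x, ∑ z ∈ (B.erase x).erase y,
      Hc x * F y * G z * ((r (p x - p y) ^ 5 + E) * r (p y - p z) ^ 4 * r (p z - p x) ^ 4) :=
    sum_distinct_triples_rotate B (fun x y z =>
      Hc x * F y * G z * ((r (p x - p y) ^ 5 + E) * r (p y - p z) ^ 4 * r (p z - p x) ^ 4))
  calc |∑ x ∈ B, ∑ y ∈ B.erase x, ∑ z ∈ (B.erase x).erase y, t x y z|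
      ≤ ∑ x ∈ B, ∑ y ∈ B.erase x, ∑ z ∈ (B.erase x).erase y, |t x y z| :=
        (Finset.abs_sum_le_sum_abs _ _).trans (Finset.sum_le_sum fun x _ =>
          (Finset.abs_sum_le_sum_abs _ _).trans (Finset.sum_le_sum fun y _ =>
            Finset.abs_sum_le_sum_abs _ _))
    _ ≤ ∑ x ∈ B, ∑ y ∈ B.erase x, ∑ z ∈ (B.erase x).erase y,
          (CR * (F x * G y * Hc z * ((r (p x - p y) ^ 5 + E) * r (p y - p z) ^ 4 * r (p z - p x) ^ 4)) +
           CR * (G y * Hc z * F x * ((r (p y - p z) ^ 5 + E) * r (p z - p x) ^ 4 * r (p x - p y) ^ 4)) +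
           CR * (Hc z * F x * G y * ((r (p z - p x) ^ 5 + E) * r (p x - p y) ^ 4 * r (p y - p z) ^ 4))) := by
        refine Finset.sum_le_sum fun x hx => Finset.sum_le_sum fun y hy =>
          Finset.sum_le_sum fun z hz => (hpt x hx y hy z hz).trans_eq ?_
        ring
    _ = CR * ∑ x ∈ B, ∑ y ∈ B.erase x, ∑ z ∈ (B.erase x).erase y,
            F x * G y * Hc z * ((r (p x - p y) ^ 5 + E) * r (p y - p z) ^ 4 * r (p z - p x) ^ 4) +
        CR * ∑ x ∈ B, ∑ y ∈ B.erase x, ∑ z ∈ (B.erase x).erase y,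
            G y * Hc z * F x * ((r (p y - p z) ^ 5 + E) * r (p z - p x) ^ 4 * r (p x - p y) ^ 4) +
        CR * ∑ x ∈ B, ∑ y ∈ B.erase x, ∑ z ∈ (B.erase x).erase y,
            Hc z * F x * G y * ((r (p z - p x) ^ 5 + E) * r (p x - p y) ^ 4 * r (p y - p z) ^ 4) := by
        simp only [Finset.sum_add_distrib, Finset.mul_sum]
    _ ≤ CR * b₁ + CR * b₂ + CR * b₃ := by
        rw [e₂, e₃]
        exact add_le_add (add_le_add (mul_le_mul_of_nonneg_left h₁ hCR)
          (mul_le_mul_of_nonneg_left h₂ hCR)) (mul_le_mul_of_nonneg_left h₃ hCR)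
    _ = CR * (b₁ + b₂ + b₃) := by ring

/-! ### The stub -/

/-- Wave-3 stub: the smeared odd ring is `O(a log S)` for disjointly supported Schwartz triples.
Given the ring bound `hRing` (the conclusion of `stub_ringTraceBound`), the triple sum of
`f(ax) g(ay) h(az) · ring(x̄-ȳ, ȳ-z̄, z̄-x̄)` over ordered triples of distinct points of `box 4 L`
(`a² L = 1`, torus of side `2L+1`) is at most `C a (1 + log(2L+1))`: `hRing` applies termwise
(distinct box points have distinct torus images), and the three resulting groups are cyclic
relabellings of `ringSmearing_group_bound` for `(f,g,h)`, `(g,h,f)`, `(h,f,g)`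
(`ringSmearing_triple_sum_abs_le`). [folklore] -/
theorem stub_ringSmearingBound
    (hRing : ∃ C : ℝ, ∀ (S : ℕ) [NeZero S], ∀ (H : TorusSite 4 S → Fin 4 → Fin 4 → ℝ), (∀ z i j, H z i j = torusGreen (z + Pi.single i 1) - torusGreen (z + Pi.single i 1 - Pi.single j 1) - torusGreen z + torusGreen (z - Pi.single j 1)) → ∀ (πK : TorusSite 4 S → {q : Fin 4 × Fin 4 // q.1 < q.2} → {q : Fin 4 × Fin 4 // q.1 < q.2} → ℝ), (∀ n α α', πK n α α' = (1 / 2 : ℝ) * (-(H n α.1.1 α'.1.1) * (if α.1.2 = α'.1.2 then 1 else 0) + H n α.1.1 α'.1.2 * (if α.1.2 = α'.1.1 then 1 else 0) + H n α.1.2 α'.1.1 * (if α.1.1 = α'.1.2 then 1 else 0) - H n α.1.2 α'.1.2 * (if α.1.1 = α'.1.1 then 1 else 0))) → ∀ (n₁ n₂ n₃ : TorusSite 4 S), n₁ ≠ 0 → n₂ ≠ 0 → n₃ ≠ 0 → |∑ α, ∑ α', ∑ α'', πK n₁ α α' * πK n₂ α' α'' * πK n₃ α'' α| ≤ C * (((Real.sqrt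 (∑ μ, (((n₁ μ).valMinAbs : ℤ) : ℝ) ^ 2))⁻¹ ^ 5 + ((S : ℝ) ^ 4)⁻¹) * (Real.sqrt (∑ μ, (((n₂ μ).valMinAbs : ℤ) : ℝ) ^ 2))⁻¹ ^ 4 * (Real.sqrt (∑ μ, (((n₃ μ).valMinAbs : ℤ) : ℝ) ^ 2))⁻¹ ^ 4 + ((Real.sqrt (∑ μ, (((n₂ μ).valMinAbs : ℤ) : ℝ) ^ 2))⁻¹ ^ 5 + ((S : ℝ) ^ 4)⁻¹) * (Real.sqrt (∑ μ, (((n₁ μ).valMinAbs : ℤ) : ℝ) ^ 2))⁻¹ ^ 4 * (Real.sqrt (∑ μ, (((n₃ μ).valMinAbs : ℤ) : ℝ) ^ 2))⁻¹ ^ 4 + ((Real.sqrt (∑ μ, (((n₃ μ).valMinAbs : ℤ) : ℝ) ^ 2))⁻¹ ^ 5 + ((S : ℝ) ^ 4)⁻¹) * (Real.sqrt (∑ μ, (((n₁ μ).valMinAbs : ℤ) : ℝ) ^ 2))⁻¹ ^ 4 * (Real.sqrt (∑ μ, (((n₂ μ).valMinAbs : ℤ) : ℝ) ^ 2))⁻¹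 ^ 4))
    (f g h : SchwartzMap (EuclideanSpace ℝ (Fin 4)) ℝ) (hfg : Disjoint (tsupport f) (tsupport g))
    (hfh : Disjoint (tsupport f) (tsupport h)) (hgh : Disjoint (tsupport g) (tsupport h)) :
    ∃ C : ℝ, ∀ (a : ℝ), 0 < a → a ≤ 1 → ∀ (L : ℕ), a ^ 2 * (L : ℝ) = 1 →
      ∀ (H : TorusSite 4 (2 * L + 1) → Fin 4 → Fin 4 → ℝ),
      (∀ z i j, H z i j = torusGreen (z + Pi.single i 1) - torusGreen (z + Pi.single i 1 - Pi.single j 1) -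
        torusGreen z + torusGreen (z - Pi.single j 1)) →
      ∀ (πK : TorusSite 4 (2 * L + 1) → {q : Fin 4 × Fin 4 // q.1 < q.2} → {q : Fin 4 × Fin 4 // q.1 < q.2} → ℝ),
      (∀ n α α', πK n α α' = (1 / 2 : ℝ) * (-(H n α.1.1 α'.1.1) * (if α.1.2 = α'.1.2 then 1 else 0)
          + H n α.1.1 α'.1.2 * (if α.1.2 = α'.1.1 then 1 else 0)
          + H n α.1.2 α'.1.1 * (if α.1.1 = α'.1.2 then 1 else 0)
          - H n α.1.2 α'.1.2 * (if α.1.1 = α'.1.1 then 1 else 0))) →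
      |∑ x ∈ box 4 L, ∑ y ∈ (box 4 L).erase x, ∑ z ∈ ((box 4 L).erase x).erase y,
          f (a • siteToE x) * g (a • siteToE y) * h (a • siteToE z) *
            ∑ α, ∑ α', ∑ α'',
              πK (Torus.proj (2 * L + 1) x - Torus.proj (2 * L + 1) y) α α' *
              πK (Torus.proj (2 * L + 1) y - Torus.proj (2 * L + 1) z) α' α'' *
              πK (Torus.proj (2 * L + 1) z - Torus.proj (2 * L + 1) x) α'' α| ≤
        C * a * (1 + Real.log (2 * L + 1)) := by
  obtain ⟨CR, hCR⟩ := hRing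
  obtain ⟨K₁, hK₁⟩ := ringSmearing_group_bound f g h hfg
  obtain ⟨K₂, hK₂⟩ := ringSmearing_group_bound g h f hgh
  obtain ⟨K₃, hK₃⟩ := ringSmearing_group_bound h f g hfh.symm
  refine ⟨max CR 0 * (K₁ + K₂ + K₃), ?_⟩
  intro a ha ha1 L hL H hH πK hπK
  have hR := hCR (2 * L + 1) H hH πK hπK
  refine le_of_le_of_eq (ringSmearing_triple_sum_abs_le (box 4 L) (Torus.proj (2 * L + 1))
    (fun w : TorusSite 4 (2 * L + 1) => (Real.sqrt (∑ μ, (((w μ).valMinAbs : ℤ) : ℝ) ^ 2))⁻¹)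
    ((((2 * L + 1 : ℕ) : ℝ) ^ 4)⁻¹) (max CR 0) (le_max_right _ _)
    (fun x y z => f (a • siteToE x) * g (a • siteToE y) * h (a • siteToE z) *
      ∑ α, ∑ α', ∑ α'',
        πK (Torus.proj (2 * L + 1) x - Torus.proj (2 * L + 1) y) α α' *
        πK (Torus.proj (2 * L + 1) y - Torus.proj (2 * L + 1) z) α' α'' *
        πK (Torus.proj (2 * L + 1) z - Torus.proj (2 * L + 1) x) α'' α)
    (fun x => |f (a • siteToE x)|) (fun x => |g (a • siteToE x)|) (fun x => |h (a • siteToE x)|)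
    ?_ (hK₁ a ha ha1 L hL) (hK₂ a ha ha1 L hL) (hK₃ a ha ha1 L hL)) (by ring)
  intro x hx y hy z hz
  beta_reduce
  obtain ⟨hyx, hyB⟩ := Finset.mem_erase.1 hy
  obtain ⟨hzy, hz1⟩ := Finset.mem_erase.1 hz
  obtain ⟨hzx, hzB⟩ := Finset.mem_erase.1 hz1
  have hb := hR _ _ _ (proj_sub_proj_ne_zero_of_mem_box hx hyB (Ne.symm hyx))
    (proj_sub_proj_ne_zero_of_mem_box hyB hzB (Ne.symm hzy)) (proj_sub_proj_ne_zero_of_mem_box hzB hx hzx)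
  rw [abs_mul, abs_mul, abs_mul]
  refine mul_le_mul_of_nonneg_left (hb.trans ?_) (by positivity)
  exact mul_le_mul_of_nonneg_right (le_max_left _ _) (by positivity)

end Summit.QuantumFields.YangMills.Theorems.SelfNormalisedSkewness.Negative

end
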